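import Summits.AtomisticToContinuum.HydrodynamicLimit.Theorems.ImplosionDichotomyPolynomialCompressionEosUniformGas

/-!
# The uniform hard-sphere gas on `𝕋³`: the one-level estimate for the insertion ratios

Helper file for the stub `stub_eosRatioUniform` (line `log-lipschitz-budget`, crux
`ImplosionDichotomy.PolynomialCompression`).

**The deterministic one-level estimate** (`EosUniformGas.abs_inv_qN_sub_inv_le`). Fix `σ` with
`SmallDensity uniformProfile σ`, `N`, a level `m ≤ N`, a cut-off `J ≤ N` in the exact regime
`J ε_N < 1/4`, and `K = min(J, m)`. Let `R ∈ [1, 2]` solve the limit equation at height `m`,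
`R⁻¹ = ∑_j γ_j (m/(N+1))ʲ Rʲ` (`γ_j = clusterCoeff σ j`), and suppose `|q_N(m-1-i) - R| ≤ D` for
`i < K`. Comparing the ratio identity `1/q_N(m) = ∑_{j ≤ m} C(m,j) W¹_N(j+1) r_N(m,j)`
(`inv_qN_eq_sum`) with the limit equation term by term for `j ≤ K` — where the coefficients are
EXACTLY `γ_j m(m-1)⋯(m-j+1)/(N+1)ʲ` (`EosUniformGas.coefN_uniformProfile_eq`), within
`e j²/(N+1)` of `γ_j (m/(N+1))ʲ` after the factor `r_N ≤ 2ʲ`, and `|r_N(m,j) - Rʲ| ≤ j 2ʲ D` — and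
bounding the two tails geometrically (`θ = 2 e v₁ σ³`; on the limit side the tail beyond
`K = m < J` carries the extra factor `m/(N+1) ≤ J/(N+1)`), one gets
`|1/q_N(m) - 1/R| ≤ e (J+1)³/(N+1) + κ D + 2 geomTail J + (J/(N+1)) geomTail 0`,
`κ = contractionC`. No limit is taken here; the stub file runs the strong induction on `m`.

## References

* E. Pulvirenti, D. Tsagkarogiannis, *Cluster expansion in the canonical ensemble*, Comm. Math.
  Phys. 316 (2012) 289–306, Thm. 2.1, §5.
-/

namespace Summit.AtomisticToContinuum.HydrodynamicLimit.Theorems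

open Set MeasureTheory Filter Finset
open Literature.MathematicalPhysics.KineticTheory
open Literature.Analysis.FunctionSpaces

namespace EosUniformGas

/-- The q-side terms are geometrically bounded: `|C(m,j) W¹_N(j+1) r_N(m,j)| ≤ e θʲ` for
`j ≤ m ≤ N`. [folklore] -/
theorem abs_coefN_mul_rN_le {σ : ℝ} (h : SmallDensity uniformProfile σ) {N m j : ℕ} (hm : m ≤ N)
    (hjm : j ≤ m) :
    |coefN uniformProfile σ N (fun _ => 1) m j * rN uniformProfile σ N m j| ≤
      Real.exp 1 * geomRatio uniformProfile σ ^ j := by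
  have hlam1 := h.ovDensity_lt_one
  have hlam0 := h.ovDensity_nonneg
  have hrr0 : 0 ≤ rN uniformProfile σ N m j :=
    zero_le_one.trans (one_le_rN h.σ_pos.le h.σ_lt_half hlam1 (by omega) hjm)
  have hrr2 : rN uniformProfile σ N m j ≤ 2 ^ j := h.rN_le_two_pow (by omega) hjm
  have hco := abs_coefN_le (P := uniformProfile) h.σ_pos.le h.σ_lt_half (g := fun _ => (1 : ℝ))
    measurable_const (C := 1) (fun _ => by simp) (N := N) (m := m) (j := j) (by omega) (by omega)
  rw [one_mul] at hco
  rw [abs_mul, abs_of_nonneg hrr0]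
  calc |coefN uniformProfile σ N (fun _ => 1) m j| * rN uniformProfile σ N m j
      ≤ (Real.exp 1 * (Real.exp 1 * ovDensity uniformProfile σ) ^ j) * 2 ^ j :=
        mul_le_mul hco hrr2 hrr0 (by positivity)
    _ = Real.exp 1 * geomRatio uniformProfile σ ^ j := by
        rw [geomRatio, mul_assoc, ← mul_pow]; ring_nf

/-- **The head terms**: for `j ≤ J` in the exact regime and `j ≤ m`, if `|q_N(m-1-i) - R| ≤ D`
for `i < j` (`0 ≤ R ≤ 2`, `0 ≤ D`), then
`|C(m,j) W¹_N(j+1) r_N(m,j) - γ_j (m/(N+1))ʲ Rʲ| ≤ e J²/(N+1) + e j θʲ D`. [folklore] -/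
theorem abs_head_sub_le {σ : ℝ} (h : SmallDensity uniformProfile σ) {N m J j : ℕ} (hm : m ≤ N)
    (hJε : (J : ℝ) * hsDiameter σ N < 1 / 4) (hjJ : j ≤ J) (hjm : j ≤ m)
    {R D : ℝ} (hR0 : 0 ≤ R) (hR2 : R ≤ 2) (hD : 0 ≤ D)
    (hq : ∀ i < j, |qN uniformProfile σ N (m - 1 - i) - R| ≤ D) :
    |coefN uniformProfile σ N (fun _ => 1) m j * rN uniformProfile σ N m j -
        clusterCoeff σ j * ((m : ℝ) / ((N : ℝ) + 1)) ^ j * R ^ j| ≤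
      Real.exp 1 * (J : ℝ) ^ 2 / ((N : ℝ) + 1) +
        Real.exp 1 * ((j : ℝ) * geomRatio uniformProfile σ ^ j) * D := by
  have hσ := h.σ_pos
  have hσ2 := h.σ_lt_half
  have hlam1 := h.ovDensity_lt_one
  have hθ0 := h.geomRatio_nonneg
  have hθ1 := h.geomRatio_lt_one
  have he := (Real.exp_pos 1).le
  have hN : (0 : ℝ) < (N : ℝ) + 1 := by positivity
  have hu0 : (0 : ℝ) ≤ (m : ℝ) / ((N : ℝ) + 1) := by positivity
  have hu1 : (m : ℝ) / ((N : ℝ) + 1) ≤ 1 := by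
    rw [div_le_one hN]; exact_mod_cast (show m ≤ N + 1 by omega)
  have hrr0 : 0 ≤ rN uniformProfile σ N m j :=
    zero_le_one.trans (one_le_rN hσ.le hσ2 hlam1 (by omega) hjm)
  have hrr2 : rN uniformProfile σ N m j ≤ 2 ^ j := h.rN_le_two_pow (by omega) hjm
  have hrrR : |rN uniformProfile σ N m j - R ^ j| ≤ j * 2 ^ j * D :=
    abs_rN_sub_pow_le h (by omega) hR0 hR2 hjm hq
  -- the exact coefficient and its consistency
  have hjε : (j : ℝ) * hsDiameter σ N < 1 / 4 :=
    lt_of_le_of_lt (mul_le_mul_of_nonneg_right (by exact_mod_cast hjJ) (hsDiameter_pos hσ N).le) hJε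
  have hco : coefN uniformProfile σ N (fun _ => 1) m j =
      clusterCoeff σ j * ((m.descFactorial j : ℝ) / ((N : ℝ) + 1) ^ j) :=
    coefN_uniformProfile_eq hσ (by omega) hjε
  have hcons : |coefN uniformProfile σ N (fun _ => 1) m j -
      clusterCoeff σ j * ((m : ℝ) / ((N : ℝ) + 1)) ^ j| ≤
        |clusterCoeff σ j| * ((j : ℝ) ^ 2 / ((N : ℝ) + 1)) := by
    rw [hco, ← mul_sub, abs_mul]
    exact mul_le_mul_of_nonneg_left (abs_descFactorial_div_sub_pow_le hjm (by omega)) (abs_nonneg _)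
  have hcc : |clusterCoeff σ j| * 2 ^ j ≤ Real.exp 1 * geomRatio uniformProfile σ ^ j :=
    abs_clusterCoeff_mul_two_pow_le hσ hσ2 j
  have hθj : geomRatio uniformProfile σ ^ j ≤ 1 := pow_le_one₀ hθ0 hθ1.le
  have hjJ' : (j : ℝ) ^ 2 ≤ (J : ℝ) ^ 2 := pow_le_pow_left₀ (Nat.cast_nonneg j) (Nat.cast_le.mpr hjJ) 2
  have hsplit : coefN uniformProfile σ N (fun _ => 1) m j * rN uniformProfile σ N m j -
      clusterCoeff σ j * ((m : ℝ) / ((N : ℝ) + 1)) ^ j * R ^ j =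
        (coefN uniformProfile σ N (fun _ => 1) m j -
            clusterCoeff σ j * ((m : ℝ) / ((N : ℝ) + 1)) ^ j) * rN uniformProfile σ N m j +
          clusterCoeff σ j * ((m : ℝ) / ((N : ℝ) + 1)) ^ j * (rN uniformProfile σ N m j - R ^ j) := by
    ring
  rw [hsplit]
  calc |(coefN uniformProfile σ N (fun _ => 1) m j -
            clusterCoeff σ j * ((m : ℝ) / ((N : ℝ) + 1)) ^ j) * rN uniformProfile σ N m j +
          clusterCoeff σ j * ((m : ℝ) / ((N : ℝ) + 1)) ^ j * (rN uniformProfile σ N m j - R ^ j)|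
      ≤ |coefN uniformProfile σ N (fun _ => 1) m j -
            clusterCoeff σ j * ((m : ℝ) / ((N : ℝ) + 1)) ^ j| * rN uniformProfile σ N m j +
          |clusterCoeff σ j| * ((m : ℝ) / ((N : ℝ) + 1)) ^ j * |rN uniformProfile σ N m j - R ^ j| := by
        refine (abs_add_le _ _).trans (le_of_eq ?_)
        rw [abs_mul, abs_of_nonneg hrr0, abs_mul, abs_mul, abs_of_nonneg (pow_nonneg hu0 j)]
    _ ≤ (|clusterCoeff σ j| * ((j : ℝ) ^ 2 / ((N : ℝ) + 1))) * 2 ^ j +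
          |clusterCoeff σ j| * ((m : ℝ) / ((N : ℝ) + 1)) ^ j * (j * 2 ^ j * D) :=
        add_le_add (mul_le_mul hcons hrr2 hrr0 (by positivity))
          (mul_le_mul_of_nonneg_left hrrR (by positivity))
    _ = (|clusterCoeff σ j| * 2 ^ j) * ((j : ℝ) ^ 2 / ((N : ℝ) + 1)) +
          (|clusterCoeff σ j| * 2 ^ j) * ((m : ℝ) / ((N : ℝ) + 1)) ^ j * ((j : ℝ) * D) := by ring
    _ ≤ (Real.exp 1 * geomRatio uniformProfile σ ^ j) * ((j : ℝ) ^ 2 / ((N : ℝ) + 1)) +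
          (Real.exp 1 * geomRatio uniformProfile σ ^ j) * ((m : ℝ) / ((N : ℝ) + 1)) ^ j *
            ((j : ℝ) * D) :=
        add_le_add (mul_le_mul_of_nonneg_right hcc (by positivity))
          (mul_le_mul_of_nonneg_right (mul_le_mul_of_nonneg_right hcc (pow_nonneg hu0 j))
            (mul_nonneg (Nat.cast_nonneg j) hD))
    _ ≤ (Real.exp 1 * 1) * ((J : ℝ) ^ 2 / ((N : ℝ) + 1)) +
          (Real.exp 1 * geomRatio uniformProfile σ ^ j) * 1 * ((j : ℝ) * D) :=
        add_le_add (mul_le_mul (mul_le_mul_of_nonneg_left hθj he)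
            (div_le_div_of_nonneg_right hjJ' hN.le) (by positivity) (by positivity))
          (mul_le_mul_of_nonneg_right (mul_le_mul_of_nonneg_left (pow_le_one₀ hu0 hu1)
            (by positivity)) (mul_nonneg (Nat.cast_nonneg j) hD))
    _ = _ := by ring

/-- **The tail of the ratio identity** beyond `K = min(J, m)`:
`|∑_{K < j ≤ m} C(m,j) W¹_N(j+1) r_N(m,j)| ≤ geomTail J` (empty if `K = m`, the geometric tail
if `K = J`). [folklore] -/
theorem abs_sum_Ico_le {σ : ℝ} (h : SmallDensity uniformProfile σ) {N m J K : ℕ} (hm : m ≤ N)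
    (hKJ : K ≤ J) (hK : J ≤ K ∨ m ≤ K) :
    |∑ j ∈ Finset.Ico (K + 1) (m + 1), coefN uniformProfile σ N (fun _ => 1) m j * rN uniformProfile σ N m j| ≤
      geomTail uniformProfile σ J := by
  rcases hK with hJK | hmK
  · have hKJ' : K = J := le_antisymm hKJ hJK
    rw [hKJ']
    refine (abs_sum_le_sum_abs _ _).trans ?_
    have hterm : ∀ j ∈ Finset.Ico (J + 1) (m + 1),
        |coefN uniformProfile σ N (fun _ => 1) m j * rN uniformProfile σ N m j| ≤
          Real.exp 1 * geomRatio uniformProfile σ ^ j := fun j hj =>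
      abs_coefN_mul_rN_le h hm (Nat.lt_succ_iff.mp (Finset.mem_Ico.mp hj).2)
    refine (sum_le_sum hterm).trans ?_
    rw [← mul_sum]
    exact h.sum_Ico_geomRatio_pow_le J (m + 1)
  · rw [Finset.Ico_eq_empty_of_le (by omega), sum_empty, abs_zero]
    exact h.geomTail_nonneg J

/-- **The tail of the limit series** beyond `K = min(J, m)` at height `m ≤ N`:
`|∑_{j > K} γ_j (m/(N+1))ʲ Rʲ| ≤ geomTail J + (J/(N+1)) geomTail 0` for `|R| ≤ 2` (the geometric
tail if `K = J`; if `K = m < J` every term carries a factor `(m/(N+1))ʲ ≤ m/(N+1) ≤ J/(N+1)`).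
[folklore] -/
theorem abs_tsum_tail_le {σ : ℝ} (h : SmallDensity uniformProfile σ) {N m J K : ℕ} (hm : m ≤ N)
    (hKJ : K ≤ J) (hK : J ≤ K ∨ m ≤ K) {R : ℝ} (hR : |R| ≤ 2) :
    |∑' j : ℕ, clusterCoeff σ (j + (K + 1)) * ((m : ℝ) / ((N : ℝ) + 1)) ^ (j + (K + 1)) *
        R ^ (j + (K + 1))| ≤
      geomTail uniformProfile σ J + (J : ℝ) / ((N : ℝ) + 1) * geomTail uniformProfile σ 0 := by
  have hσ := h.σ_pos
  have hσ2 := h.σ_lt_half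
  have hθ0 := h.geomRatio_nonneg
  have hθ1 := h.geomRatio_lt_one
  have he0 : 0 ≤ Real.exp 1 := (Real.exp_pos 1).le
  have hN : (0 : ℝ) < (N : ℝ) + 1 := by positivity
  have hu0 : (0 : ℝ) ≤ (m : ℝ) / ((N : ℝ) + 1) := by positivity
  have hu1 : (m : ℝ) / ((N : ℝ) + 1) ≤ 1 := by
    rw [div_le_one hN]; exact_mod_cast (show m ≤ N + 1 by omega)
  -- the majorant
  have hgeo : HasSum (fun j : ℕ => Real.exp 1 * geomRatio uniformProfile σ ^ (j + (J + 1)) +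
      (J : ℝ) / ((N : ℝ) + 1) * (Real.exp 1 * geomRatio uniformProfile σ ^ (j + 1)))
      (geomTail uniformProfile σ J + (J : ℝ) / ((N : ℝ) + 1) * geomTail uniformProfile σ 0) := by
    have hg := hasSum_geometric_of_lt_one hθ0 hθ1
    have h1 : HasSum (fun j : ℕ => Real.exp 1 * geomRatio uniformProfile σ ^ (j + (J + 1)))
        (geomTail uniformProfile σ J) := by
      have h' := hg.mul_left (Real.exp 1 * geomRatio uniformProfile σ ^ (J + 1))
      rw [geomTail, div_eq_mul_inv]
      refine h'.congr_fun fun j => ?_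
      rw [pow_add]; ring
    have h2 : HasSum (fun j : ℕ => Real.exp 1 * geomRatio uniformProfile σ ^ (j + 1))
        (geomTail uniformProfile σ 0) := by
      have h' := hg.mul_left (Real.exp 1 * geomRatio uniformProfile σ)
      rw [geomTail, zero_add, pow_one, div_eq_mul_inv]
      refine h'.congr_fun fun j => ?_
      rw [pow_succ]; ring
    exact h1.add (h2.mul_left _)
  refine (Real.norm_eq_abs _).symm.trans_le (tsum_of_norm_bounded hgeo fun j => ?_)
  rw [Real.norm_eq_abs]
  have hb := abs_clusterCoeff_mul_pow_mul_pow_le hσ hσ2 hR N m (j + (K + 1))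
  have ht1 : 0 ≤ Real.exp 1 * geomRatio uniformProfile σ ^ (j + (J + 1)) := by positivity
  have ht2 : 0 ≤ (J : ℝ) / ((N : ℝ) + 1) * (Real.exp 1 * geomRatio uniformProfile σ ^ (j + 1)) := by
    positivity
  refine hb.trans ?_
  rcases hK with hJK | hmK
  · -- `K = J`: the plain geometric tail
    have hKJ' : K = J := le_antisymm hKJ hJK
    rw [hKJ']
    calc Real.exp 1 * geomRatio uniformProfile σ ^ (j + (J + 1)) *
          ((m : ℝ) / ((N : ℝ) + 1)) ^ (j + (J + 1))
        ≤ Real.exp 1 * geomRatio uniformProfile σ ^ (j + (J + 1)) :=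
          mul_le_of_le_one_right ht1 (pow_le_one₀ hu0 hu1)
      _ ≤ _ := le_add_of_nonneg_right ht2
  · -- `K = m ≤ J`: every term carries a factor `m/(N+1) ≤ J/(N+1)`
    have hmJ : m ≤ J := hmK.trans hKJ
    have hpow1 : geomRatio uniformProfile σ ^ (j + (K + 1)) ≤ geomRatio uniformProfile σ ^ (j + 1) :=
      pow_le_pow_of_le_one hθ0 hθ1.le (by omega)
    have hpow2 : ((m : ℝ) / ((N : ℝ) + 1)) ^ (j + (K + 1)) ≤ (m : ℝ) / ((N : ℝ) + 1) :=
      pow_le_of_le_one hu0 hu1 (by omega)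
    have hmJr : (m : ℝ) / ((N : ℝ) + 1) ≤ (J : ℝ) / ((N : ℝ) + 1) :=
      div_le_div_of_nonneg_right (by exact_mod_cast hmJ) hN.le
    calc Real.exp 1 * geomRatio uniformProfile σ ^ (j + (K + 1)) *
          ((m : ℝ) / ((N : ℝ) + 1)) ^ (j + (K + 1))
        ≤ Real.exp 1 * geomRatio uniformProfile σ ^ (j + 1) * ((J : ℝ) / ((N : ℝ) + 1)) :=
          mul_le_mul (mul_le_mul_of_nonneg_left hpow1 he0) (hpow2.trans hmJr) (pow_nonneg hu0 _)
            (by positivity)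
      _ = (J : ℝ) / ((N : ℝ) + 1) * (Real.exp 1 * geomRatio uniformProfile σ ^ (j + 1)) := by ring
      _ ≤ _ := le_add_of_nonneg_left ht1

/-- **The one-level estimate for the uniform gas.** Let `SmallDensity uniformProfile σ`,
`m ≤ N`, `J ≤ N` with `J ε_N < 1/4` (exact regime), `K ≤ min(J, m)` with `K = J` or `K = m`.
If `R ∈ [1, 2]` solves the limit equation at height `m`, `R⁻¹ = ∑_j γ_j (m/(N+1))ʲ Rʲ`, and
`|q_N(m-1-i) - R| ≤ D` for `i < K` (`0 ≤ D`), then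
`|1/q_N(m) - 1/R| ≤ e (J+1)³/(N+1) + κ D + 2 geomTail J + (J/(N+1)) geomTail 0`. [folklore] -/
theorem abs_inv_qN_sub_inv_le {σ : ℝ} (h : SmallDensity uniformProfile σ) {N m J K : ℕ}
    (hm : m ≤ N) (hJε : (J : ℝ) * hsDiameter σ N < 1 / 4) (hKJ : K ≤ J)
    (hKm : K ≤ m) (hK : J ≤ K ∨ m ≤ K) {R D : ℝ} (hR1 : 1 ≤ R) (hR2 : R ≤ 2)
    (hRe : R⁻¹ = ∑' j : ℕ, clusterCoeff σ j * ((m : ℝ) / ((N : ℝ) + 1)) ^ j * R ^ j)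
    (hD : 0 ≤ D) (hq : ∀ i < K, |qN uniformProfile σ N (m - 1 - i) - R| ≤ D) :
    |(qN uniformProfile σ N m)⁻¹ - R⁻¹| ≤
      Real.exp 1 * ((J : ℝ) + 1) ^ 3 / ((N : ℝ) + 1) + contractionC uniformProfile σ * D +
        2 * geomTail uniformProfile σ J +
          (J : ℝ) / ((N : ℝ) + 1) * geomTail uniformProfile σ 0 := by
  have hσ := h.σ_pos
  have hσ2 := h.σ_lt_half
  have hlam1 := h.ovDensity_lt_one
  have hθ1 := h.geomRatio_lt_one
  have hR0 : 0 ≤ R := by linarith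
  have hRabs : |R| ≤ 2 := abs_le.2 ⟨by linarith, hR2⟩
  have hN : (0 : ℝ) < (N : ℝ) + 1 := by positivity
  set a : ℕ → ℝ := fun j => coefN uniformProfile σ N (fun _ => 1) m j * rN uniformProfile σ N m j
    with ha
  set b : ℕ → ℝ := fun j => clusterCoeff σ j * ((m : ℝ) / ((N : ℝ) + 1)) ^ j * R ^ j with hb
  have hsum_b : Summable b := summable_clusterCoeff_mul_pow_mul_pow hσ hσ2 hθ1 hRabs (by omega)
  -- the two decompositions
  have hq_eq : (qN uniformProfile σ N m)⁻¹ =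
      ∑ j ∈ range (K + 1), a j + ∑ j ∈ Finset.Ico (K + 1) (m + 1), a j := by
    rw [inv_qN_eq_sum hσ.le hσ2 hlam1 hm, Finset.sum_range_add_sum_Ico _ (by omega)]
  have hR_eq : R⁻¹ = ∑ j ∈ range (K + 1), b j + ∑' j, b (j + (K + 1)) := by
    rw [hRe, ← hsum_b.sum_add_tsum_nat_add (K + 1)]
  -- head terms
  have hhead : ∀ j ∈ range (K + 1), |a j - b j| ≤ Real.exp 1 * (J : ℝ) ^ 2 / ((N : ℝ) + 1) +
      Real.exp 1 * ((j : ℝ) * geomRatio uniformProfile σ ^ j) * D := by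
    intro j hj
    have hjK : j ≤ K := Nat.lt_succ_iff.mp (mem_range.mp hj)
    exact abs_head_sub_le h hm hJε (hjK.trans hKJ) (hjK.trans hKm) hR0 hR2 hD
      fun i hi => hq i (lt_of_lt_of_le hi hjK)
  have hhead_sum : |∑ j ∈ range (K + 1), (a j - b j)| ≤
      Real.exp 1 * ((J : ℝ) + 1) ^ 3 / ((N : ℝ) + 1) + contractionC uniformProfile σ * D := by
    refine (abs_sum_le_sum_abs _ _).trans ((sum_le_sum hhead).trans ?_)
    rw [sum_add_distrib, sum_const, card_range, nsmul_eq_mul, ← sum_mul, ← mul_sum]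
    have hκ := h.sum_mul_geomRatio_pow_le K
    have hK1 : ((K + 1 : ℕ) : ℝ) ≤ (J : ℝ) + 1 := by exact_mod_cast Nat.succ_le_succ hKJ
    have hJ2 : (J : ℝ) ^ 2 ≤ ((J : ℝ) + 1) ^ 2 := by gcongr; linarith
    have he := (Real.exp_pos 1).le
    have h1 : ((K + 1 : ℕ) : ℝ) * (Real.exp 1 * (J : ℝ) ^ 2 / ((N : ℝ) + 1)) ≤
        Real.exp 1 * ((J : ℝ) + 1) ^ 3 / ((N : ℝ) + 1) :=
      calc ((K + 1 : ℕ) : ℝ) * (Real.exp 1 * (J : ℝ) ^ 2 / ((N : ℝ) + 1))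
          ≤ ((J : ℝ) + 1) * (Real.exp 1 * ((J : ℝ) + 1) ^ 2 / ((N : ℝ) + 1)) :=
            mul_le_mul hK1 (div_le_div_of_nonneg_right (mul_le_mul_of_nonneg_left hJ2 he) hN.le)
              (by positivity) (by positivity)
        _ = _ := by ring
    have h2 : Real.exp 1 * (∑ j ∈ range (K + 1), (j : ℝ) * geomRatio uniformProfile σ ^ j) * D ≤
        contractionC uniformProfile σ * D := mul_le_mul_of_nonneg_right hκ hD
    linarith
  -- the tails
  have htail_a : |∑ j ∈ Finset.Ico (K + 1) (m + 1), a j| ≤ geomTail uniformProfile σ J :=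
    abs_sum_Ico_le h hm hKJ hK
  have htail_b : |∑' j, b (j + (K + 1))| ≤
      geomTail uniformProfile σ J + (J : ℝ) / ((N : ℝ) + 1) * geomTail uniformProfile σ 0 :=
    abs_tsum_tail_le h hm hKJ hK hRabs
  -- assemble
  have hdiff : (qN uniformProfile σ N m)⁻¹ - R⁻¹ = ∑ j ∈ range (K + 1), (a j - b j) +
      ∑ j ∈ Finset.Ico (K + 1) (m + 1), a j - ∑' j, b (j + (K + 1)) := by
    rw [hq_eq, hR_eq, sum_sub_distrib]; ring
  rw [hdiff]
  calc |∑ j ∈ range (K + 1), (a j - b j) + ∑ j ∈ Finset.Ico (K + 1) (m + 1), a j - ∑' j, b (j + (K + 1))|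
      ≤ |∑ j ∈ range (K + 1), (a j - b j) + ∑ j ∈ Finset.Ico (K + 1) (m + 1), a j| +
          |∑' j, b (j + (K + 1))| := abs_sub _ _
    _ ≤ |∑ j ∈ range (K + 1), (a j - b j)| + |∑ j ∈ Finset.Ico (K + 1) (m + 1), a j| +
          |∑' j, b (j + (K + 1))| := by gcongr; exact abs_add_le _ _
    _ ≤ _ := by linarith

end EosUniformGas

/-- **The one-level estimate for the uniform hard-sphere gas** (main statement of this helper file
for the stub `stub_eosRatioUniform`). Let `SmallDensity uniformProfile σ`, `m ≤ N`, `J ε_N < 1/4`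
(exact regime), `K ≤ min(J, m)` with `K = J` or `K = m`; if `R ∈ [1, 2]` solves the limit
equation at height `m`, `R⁻¹ = ∑_j γ_j (m/(N+1))ʲ Rʲ`, and `|q_N(m-1-i) - R| ≤ D` for `i < K`
(`0 ≤ D`), then `|1/q_N(m) - 1/R| ≤ e (J+1)³/(N+1) + κ D + 2 geomTail J + (J/(N+1)) geomTail 0`.
[folklore] -/
theorem uniformGas_abs_inv_qN_sub_inv_le :
    ∀ {σ : ℝ} {N m J K : ℕ} {R D : ℝ}, SmallDensity uniformProfile σ → m ≤ N →
      (J : ℝ) * hsDiameter σ N < 1 / 4 → K ≤ J → K ≤ m → (J ≤ K ∨ m ≤ K) → 1 ≤ R → R ≤ 2 →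
      R⁻¹ = ∑' j : ℕ, clusterCoeff σ j * ((m : ℝ) / ((N : ℝ) + 1)) ^ j * R ^ j → 0 ≤ D →
      (∀ i < K, |qN uniformProfile σ N (m - 1 - i) - R| ≤ D) →
      |(qN uniformProfile σ N m)⁻¹ - R⁻¹| ≤
        Real.exp 1 * ((J : ℝ) + 1) ^ 3 / ((N : ℝ) + 1) + contractionC uniformProfile σ * D +
          2 * geomTail uniformProfile σ J +
            (J : ℝ) / ((N : ℝ) + 1) * geomTail uniformProfile σ 0 := by
  intro σ N m J K R D h hm hJε hKJ hKm hK hR1 hR2 hRe hD hq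
  exact EosUniformGas.abs_inv_qN_sub_inv_le h hm hJε hKJ hKm hK hR1 hR2 hRe hD hq

end Summit.AtomisticToContinuum.HydrodynamicLimit.Theorems
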